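import Literature.MathematicalPhysics.QuantumFieldTheory.Balaban1983to89.B15Ineq146Proof
import Literature.MathematicalPhysics.QuantumFieldTheory.Balaban1983to89.B14Sect3
import Literature.MathematicalPhysics.QuantumFieldTheory.Balaban1983to89.B15BasicStep

/-!
# `Balaban1983to89.B14Ineq38Proof` — T. Bałaban, *Convergent renormalization expansions for lattice gauge theories*,
# Commun. Math. Phys. **119** (1988) 243–285 [Balaban1988Convergent], (3.8) p. 266: the FIRST member of (3.8)
# (*"This estimate [(3.7)] and the equalities (3.7) [sic: (3.6)], (1.43) [14] imply (3.8)"*) PROVED on the `ℤ^d`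
# lattice carriers, r11's chain `B14Sect3.Ineq38Printed` DISCHARGED; and its verbatim re-use *"Estimating
# ∂U_{j,□} as in (3.8) [III]"* = the FIRST member of (1.31) p. 184 of *Large field renormalization. I*
# [Balaban1989LargeFieldI], PROVED in b01's letters `B15.BasicStep.expr131a`

statement-level skeleton of published theorems with citation tags; proofs where landed; nothing here is a claim
about the Yang–Mills mass gap

PDF held: `paper:balaban1988-cmp119-convergent-renormalization` (journal page = PDF page + 242), pp. 265–266
[PDF 23–24] READ AS IMAGES (`…/1988-cmp119-convergent-renormalization-p023/p024-x2.png`);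
`paper:balaban1989-cmp122-large-field-i` (journal page = PDF page + 174), p. 184 [PDF 10] READ AS AN IMAGE
(`…/1989-cmp122-large-field-I-p010-x2.png`).  "[14]" = [Balaban1985RegularSpaces] ((1.43) p. 83, tree
`B8Eq143PlaqExpansion.eq143`/`eq121`); "[III]" (in [Balaban1989LargeFieldI]) = [Balaban1988Convergent].

WHAT IS REPRODUCED.  SKELETON rows **B14.Claim@265** ((3.8); rows of record `lit-balaban-r11/ROWS-B14.md`:
"(3.7), (3.8) as Props + arithmetic PROVED" — r11's `B14Sect3.Ineq38Printed u ε_k ε_{k+1} η L β₀` is the printed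
three-member chain for ONE real `u = |U_{k,□}(∂p) − 1|`, whose first member was the HYPOTHESIS `hfirst` of
`B14Sect3.ineq38Printed_of_first` / `ineq38_conclusion`) and **B15.Eq1.31** ((1.31) first member; rows of record
`lit-balaban-r12/ROWS-B15.md`: "typed-existing · member 1 = [III] input"; b01's `B15.BasicStep.expr131a`,
`expr131a_le`, `coeff131_lt_one`; r12's `B15SmallField185.sf13_of_131` takes member 1 as hypothesis `h131` on the
`Setup` torus carrier).  Mega-formalization `lit-balaban`, HOME `run/shared/lean/pub/lit-balaban/`, Phase-2 proof seat
`p29` gen 6 (unit `lit-balaban-p29`).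

THE PRINTED TEXT.  [III] p. 266 (verbatim from the render): *"□⊂□′⊂Ω~_{k+1}. For the function U_{k,□} we have
U_{k,□} = U(𝐁_k(□^{~4}), [M˙(Q_k^{s*}V_k)(M˙(U_{k+1,□′}))⁻¹]M˙(U_{k+1,□′}))
= (exp iη𝐇_{k,□}((1/i) log[M˙(Q_k^{s*}V_k)(M˙(U_{k+1,□′}))⁻¹]) U_{k+1,□′})^{u⁻¹_{k,□}}. (3.6)  On almost the whole
cube □^{~4}, except a boundary layer of the width 2M₁, the field in the argument of the function 𝐇_{k,□} is equal
to (1/i) log[V_k(V^{(k)}_{□′})⁻¹], hence it can be bounded by 4δ_k. On the boundary layer this field can be bounded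
by 30d²L²B₃(1+β₀)ε_k … By the exponential decay property (190) [15] we obtain the estimate
|𝐇_{k,□}|, |∇^η_{U_{k+1,□′}}𝐇_{k,□}| ≦ B₃(4δ_k + exp(−δ2M₂R_k)30d²L²B₃(1+β₀)ε_k) < (4B₃A₁/A₀ + 30d²L²B₃²(1+β₀)exp(−R_k))ε_k
< (1/10)ε_k on □~, (3.7)  for A₁/A₀ and γ sufficiently small. This estimate and the equalities (3.7), (1.43) [14]
imply  |U_{k,□}(∂p) − 1| < (1 + (2/10)ε_kη)ε_{k+1}(L⁻¹η)² + (2/10)ε_kη²(1 + (4/10)ε_k) < 2(1+β₀)L⁻²ε_kη² + (4/10)ε_kη²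
< ε_kη² for p⊂□~. (3.8)  Thus χ_k(□) = 1 for □⊂Ω~_{k+1}."*  (p. 265, (3.2): the small-field function
`χ({sup_{p⊂□′~}|U_{k+1,□′}(∂p) − 1| < ε_{k+1}(L⁻¹η)²})` — the source of the factor `ε_{k+1}(L⁻¹η)²`.)
[IV] p. 184 (verbatim from the render): *"The exponential decay property of ℍ_{j,□} implies that on the cube □~ this
function and its covariant derivatives can be bounded by B₃exp(−δ2M₂R_j)22d²ε_j < (β/10)ε_j. Estimating ∂U_{j,□} as
in (3.8) [III] we obtain  |U_{j,□}(∂p) − 1| < (1 + (2β/10)ε_jξ)(1 − β½)ε_jξ² + (2β/10)ε_jξ²(1 + (4β/10)ε_j)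
< (1 − β/2 + (2β/10)L⁻² + 4β/10)ε_jξ² < ε_j(L^{k−j}η)² for p⊂□~. (1.31)  Thus the functions (1.3) in the product on the
left-hand side of (1.29) are equal to 1."*, with (1.30) p. 183 `U_{j,□} = (exp iξℍ_{j,□}(…)U^{(n)}_k)^{u⁻¹_{j,□}}`,
`ξ = L^{k−j}η`, and the `χ^{(n)}_k`-restriction `|U^{(n)}_k(∂p) − 1| < (1 − β½)ε_jξ²` ((1.24), top line, `c = 1`).

THE ARGUMENT FORMALISED.  Both displays are ONE estimate — the plaquette-perturbation MECHANISM of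
`B15Ineq146Proof.mechanism_iEta` ((1.21)/(1.43) of [14] + the sharp unitary second-order Taylor bound): for
`U = (e^{iηH}U₀)^{g}`, `|U(∂p) − 1| ≤ |U₀(∂p) − 1| + η²|(D^η_{U₀}H)(p)| + ½η²(Σ_{b⊂∂p}|H(b)|)²`.  If `|U₀(∂p) − 1| < D`
and `|H(b)| ≤ X` on the four bonds of `∂p`, `|(∇^η_{U₀,μ}H_ν)(x)|, |(∇^η_{U₀,ν}H_μ)(x)| ≤ X`, then
`|U(∂p) − 1| < (1 + 2ηX)D + 2η²X(1 + 4X)` (`smallField_transfer`: `½η·4X = 2ηX`, `η²·2X + ½η²(4X)² = 2η²X(1 + 4X)`, the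
cross term `2ηX·D ≥ 0` being print's slack).  (3.8): `X = ε_k/10`, `D = ε_{k+1}(L⁻¹η)²` gives the first member with
EXACTLY the printed coefficients `(2/10)ε_kη`, `(2/10)ε_kη²`, `(4/10)ε_k` (`ineq38_first`), whence r11's chain
(`ineq38Printed_lattice`) and *"Thus χ_k(□) = 1"* (`ineq38_lt`).  (1.31): `η ↦ ξ`, `X = (β/10)ε_j`,
`D = (1 − β½)ε_jξ²` gives `expr131a β ε_j ξ` EXACTLY (`ineq131_first`), whence `< coeff131 β L·ε_jξ² < ε_jξ²` by b01's
`expr131a_le`/`coeff131_lt_one` (`ineq131_lt`).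

MODEL / DECLARED DEVIATIONS (referee columns F6/F7; those of `B15Ineq146Proof` (M1)–(M5) inherited: `ℤ^d` sites,
values in a unital C⋆-algebra `𝔸`, `G` ⊂ unitaries, `𝔤` = hermitian part, `U₀`, `g` only `U1`-valued, `H` an
arbitrary hermitian bond field standing for `𝐇_{k,□}(…)` / `ℍ_{j,□}(…)`).  (M6) (3.7) / the «(β/10)ε_j» bound enter as
NON-STRICT bounds `≤ X` at the four bonds of `∂p` and the two covariant derivatives at `x` (print: strict, on all of
`□~` — weaker hypotheses, same conclusion); the χ-restrictions on the background enter as the strict `|U₀(∂p) − 1| < D`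
at the plaquette in hand.  (M7) (1.31) is proved on the `ℤ^d`/C⋆ carrier in b01's letters `expr131a β ε_j ξ`
(`ξ = L^{k−j}η = L^{−j}` a free positive real; as in print's "as in (3.8) [III]", ONE lattice of spacing `ξ` — print's `T_ξ`,
p. 183 — carries the plaquette `p`, the perturbation `e^{iξℍ}` and the covariant derivative `∇^ξ`, i.e. (3.8) with
`η ↦ ξ`, `ε_k/10 ↦ (β/10)ε_j`, `ε_{k+1}(L⁻¹η)² ↦ (1 − β½)ε_jξ²`); r12's `sf13_of_131` lives on the `Setup` torus carrier
`GaugeField P i G` — the present theorem is the `ℤ^d` twin of its hypothesis `h131`, not a literal discharge (different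
carriers of record).
(M8) No smallness beyond print's: (3.8) second/third members use r11's hypotheses verbatim (`0 < ε_k ≤ 1`, `0 < η ≤ 1`,
`L > 0`, `0 < ε_{k+1} ≤ (1+β₀)ε_k`, `2(1+β₀)L⁻² + 4/10 < 1`); (1.31) second/third members use b01's (`0 ≤ β ≤ 1`,
`β > 0`, `0 ≤ ε_j ≤ 1`, `ε_jξ ≤ L⁻²` — the cell's located smallness C-B15 — and `L ≥ 2`).  Net new unproved facts: 0
(theorems only; no `def`).
-/

open scoped BigOperators
open NormedSpace Finset Complex

namespace Literature.MathematicalPhysics.QuantumFieldTheory.Balaban1983to89.B14Ineq38Proof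

open B7Prop1Explicit
open B8Lemma1NonAbelian (mulCfg)
open B8Ineq132 (plaqF covDerivFwd)
open B8Eq146AExpansion (plaqCovDeriv expCfg iEta)
open B15Ineq146Proof (mechanism_iEta norm_plaqCovDeriv_le)

-- `Site` alone could resolve to the torus sites of `Setup.lean` through a parent namespace; re-export the `ℤ^d`
-- sites of `B7Prop1Explicit`.
export B7Prop1Explicit (Site)

variable {d : ℕ}
variable {𝔸 : Type*} [CStarAlgebra 𝔸] [Nontrivial 𝔸]

/-! ## §1 The small-field transfer (the common content of (3.8) [III] and (1.31) [IV]) -/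

/-- **SMALL-FIELD TRANSFER THROUGH `U = (e^{iηH}U₀)^{g}`.**  For `U₀`, `g` valued in `{|u| ≤ 1, |u⁻¹| ≤ 1}`, `H`
hermitian, `η > 0`, at a plaquette `p = p_{μν}(x)`: if `|U₀(∂p) − 1| < D`, `|H(b)| ≤ X` on the four bonds of `∂p` and
`|(∇^η_{U₀,μ}H_ν)(x)|, |(∇^η_{U₀,ν}H_μ)(x)| ≤ X`, then `|U(∂p) − 1| < (1 + 2ηX)D + 2η²X(1 + 4X)` — the mechanism
`B15Ineq146Proof.mechanism_iEta` with `½ηΣ_{b⊂∂p}|H(b)| ≤ 2ηX`, `η²|(D^η_{U₀}H)(p)| ≤ 2η²X`, `½η²(Σ|H(b)|)² ≤ 8η²X²`.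
[cite: Balaban1988Convergent, (3.8) p.266] -/
theorem smallField_transfer {η : ℝ} (hη : 0 < η) {U₀ : Site d → Fin d → 𝔸ˣ} (h₀ : ∀ y κ, U₀ y κ ∈ U1 𝔸)
    {H : Site d → Fin d → 𝔸} (hH : ∀ y κ, IsSelfAdjoint (H y κ)) {g : Site d → 𝔸ˣ} (hg : ∀ y, g y ∈ U1 𝔸)
    (μ ν : Fin d) (x : Site d) {D X : ℝ} (hdev₀ : ‖plaqF U₀ μ ν x - 1‖ < D)
    (hH₁ : ‖H x μ‖ ≤ X) (hH₂ : ‖H (x + e μ) ν‖ ≤ X) (hH₃ : ‖H (x + e ν) μ‖ ≤ X) (hH₄ : ‖H x ν‖ ≤ X)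
    (hDH₁ : ‖covDerivFwd η U₀ μ (fun y => H y ν) x‖ ≤ X) (hDH₂ : ‖covDerivFwd η U₀ ν (fun y => H y μ) x‖ ≤ X) :
    ‖plaqF (gaugeAct g (mulCfg (expCfg (iEta η H)) U₀)) μ ν x - 1‖
      < (1 + 2 * η * X) * D + 2 * η ^ 2 * X * (1 + 4 * X) := by
  have hmech := mechanism_iEta hη h₀ hH hg μ ν x
  have hX : 0 ≤ X := (norm_nonneg _).trans hH₁
  have hD : 0 ≤ D := (norm_nonneg _).trans hdev₀.le
  have hS : ‖H x μ‖ + ‖H (x + e μ) ν‖ + ‖H (x + e ν) μ‖ + ‖H x ν‖ ≤ 4 * X := by linarith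
  have hS0 : 0 ≤ ‖H x μ‖ + ‖H (x + e μ) ν‖ + ‖H (x + e ν) μ‖ + ‖H x ν‖ := by positivity
  have hT₂ : η ^ 2 * ‖plaqCovDeriv η U₀ H μ ν x‖ ≤ 2 * η ^ 2 * X := by
    have h1 := norm_plaqCovDeriv_le η U₀ H μ ν x
    have h2 : ‖plaqCovDeriv η U₀ H μ ν x‖ ≤ 2 * X := by linarith
    have := mul_le_mul_of_nonneg_left h2 (sq_nonneg η)
    linarith
  have hT₃ : (η * (‖H x μ‖ + ‖H (x + e μ) ν‖ + ‖H (x + e ν) μ‖ + ‖H x ν‖)) ^ 2 / 2 ≤ 8 * η ^ 2 * X ^ 2 := by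
    have hηS : η * (‖H x μ‖ + ‖H (x + e μ) ν‖ + ‖H (x + e ν) μ‖ + ‖H x ν‖) ≤ η * (4 * X) :=
      mul_le_mul_of_nonneg_left hS hη.le
    have h1 : (η * (‖H x μ‖ + ‖H (x + e μ) ν‖ + ‖H (x + e ν) μ‖ + ‖H x ν‖)) ^ 2 ≤ (η * (4 * X)) ^ 2 :=
      pow_le_pow_left₀ (by positivity) hηS 2
    nlinarith
  have hslack : 0 ≤ 2 * η * X * D := by positivity
  nlinarith [hmech, hT₂, hT₃, hdev₀, hslack]

/-! ## §2 [III] (3.8): the first member, the printed chain, and "Thus χ_k(□) = 1" -/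

/-- **(3.8), FIRST MEMBER** (p. 266): for `U_{k,□} = (e^{iη𝐇}U_{k+1,□′})^{u⁻¹}` ((3.6)), with (3.7)
`|𝐇(b)|, |∇^η_{U_{k+1,□′}}𝐇| ≤ ε_k/10` (at the bonds of `∂p` and the two covariant derivatives at `x`) and the
small-field condition `|U_{k+1,□′}(∂p) − 1| < ε_{k+1}(L⁻¹η)²` of (3.2):
`|U_{k,□}(∂p) − 1| < (1 + (2/10)ε_kη)ε_{k+1}(L⁻¹η)² + (2/10)ε_kη²(1 + (4/10)ε_k)` — print's coefficients exactly.
[cite: Balaban1988Convergent, (3.8) p.266] -/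
theorem ineq38_first {η : ℝ} (hη : 0 < η) {U₀ : Site d → Fin d → 𝔸ˣ} (h₀ : ∀ y κ, U₀ y κ ∈ U1 𝔸)
    {H : Site d → Fin d → 𝔸} (hH : ∀ y κ, IsSelfAdjoint (H y κ)) {g : Site d → 𝔸ˣ} (hg : ∀ y, g y ∈ U1 𝔸)
    (μ ν : Fin d) (x : Site d) {εk εk1 L : ℝ} (hdev₀ : ‖plaqF U₀ μ ν x - 1‖ < εk1 * (L⁻¹ * η) ^ 2)
    (hH₁ : ‖H x μ‖ ≤ εk / 10) (hH₂ : ‖H (x + e μ) ν‖ ≤ εk / 10) (hH₃ : ‖H (x + e ν) μ‖ ≤ εk / 10)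
    (hH₄ : ‖H x ν‖ ≤ εk / 10) (hDH₁ : ‖covDerivFwd η U₀ μ (fun y => H y ν) x‖ ≤ εk / 10)
    (hDH₂ : ‖covDerivFwd η U₀ ν (fun y => H y μ) x‖ ≤ εk / 10) :
    ‖plaqF (gaugeAct g (mulCfg (expCfg (iEta η H)) U₀)) μ ν x - 1‖
      < (1 + (2/10) * εk * η) * εk1 * (L⁻¹ * η) ^ 2 + (2/10) * εk * η ^ 2 * (1 + (4/10) * εk) := by
  have h := smallField_transfer hη h₀ hH hg μ ν x hdev₀ hH₁ hH₂ hH₃ hH₄ hDH₁ hDH₂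
  have e1 : (1 + 2 * η * (εk / 10)) * (εk1 * (L⁻¹ * η) ^ 2) + 2 * η ^ 2 * (εk / 10) * (1 + 4 * (εk / 10))
      = (1 + (2/10) * εk * η) * εk1 * (L⁻¹ * η) ^ 2 + (2/10) * εk * η ^ 2 * (1 + (4/10) * εk) := by ring
  linarith [h, e1]

/-- **(3.8), THE PRINTED CHAIN** — r11's `B14Sect3.Ineq38Printed |U_{k,□}(∂p) − 1| ε_k ε_{k+1} η L β₀` with its first
member DISCHARGED by `ineq38_first`; the second and third members under r11's hypotheses verbatim (`0 < ε_k ≤ 1`,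
`0 < η ≤ 1`, `L > 0`, `0 < ε_{k+1} ≤ (1+β₀)ε_k` — the flow inequality (2.8) —, and the restriction
`2(1+β₀)L⁻² + 4/10 < 1`). [cite: Balaban1988Convergent, (3.8) p.266] -/
theorem ineq38Printed_lattice {η : ℝ} (hη : 0 < η) (hη1 : η ≤ 1) {U₀ : Site d → Fin d → 𝔸ˣ}
    (h₀ : ∀ y κ, U₀ y κ ∈ U1 𝔸) {H : Site d → Fin d → 𝔸} (hH : ∀ y κ, IsSelfAdjoint (H y κ)) {g : Site d → 𝔸ˣ}
    (hg : ∀ y, g y ∈ U1 𝔸) (μ ν : Fin d) (x : Site d) {εk εk1 L β₀ : ℝ} (hε : 0 < εk) (hε1 : εk ≤ 1)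
    (hL : 0 < L) (hε' : 0 < εk1) (hflow : εk1 ≤ (1 + β₀) * εk) (hrestr : 2 * (1 + β₀) * L⁻¹ ^ 2 + 4/10 < 1)
    (hdev₀ : ‖plaqF U₀ μ ν x - 1‖ < εk1 * (L⁻¹ * η) ^ 2)
    (hH₁ : ‖H x μ‖ ≤ εk / 10) (hH₂ : ‖H (x + e μ) ν‖ ≤ εk / 10) (hH₃ : ‖H (x + e ν) μ‖ ≤ εk / 10)
    (hH₄ : ‖H x ν‖ ≤ εk / 10) (hDH₁ : ‖covDerivFwd η U₀ μ (fun y => H y ν) x‖ ≤ εk / 10)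
    (hDH₂ : ‖covDerivFwd η U₀ ν (fun y => H y μ) x‖ ≤ εk / 10) :
    B14Sect3.Ineq38Printed ‖plaqF (gaugeAct g (mulCfg (expCfg (iEta η H)) U₀)) μ ν x - 1‖ εk εk1 η L β₀ :=
  B14Sect3.ineq38Printed_of_first _ εk εk1 η L β₀ hε hε1 hη hη1 hL hε' hflow hrestr
    (ineq38_first hη h₀ hH hg μ ν x hdev₀ hH₁ hH₂ hH₃ hH₄ hDH₁ hDH₂)

/-- **"Thus χ_k(□) = 1 for □⊂Ω~_{k+1}"** (p. 266): the last member, `|U_{k,□}(∂p) − 1| < ε_kη²`, for the lattice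
plaquette variable (r11's `B14Sect3.ineq38_conclusion` with `hfirst` discharged). [cite: Balaban1988Convergent, (3.8) p.266] -/
theorem ineq38_lt {η : ℝ} (hη : 0 < η) (hη1 : η ≤ 1) {U₀ : Site d → Fin d → 𝔸ˣ} (h₀ : ∀ y κ, U₀ y κ ∈ U1 𝔸)
    {H : Site d → Fin d → 𝔸} (hH : ∀ y κ, IsSelfAdjoint (H y κ)) {g : Site d → 𝔸ˣ} (hg : ∀ y, g y ∈ U1 𝔸)
    (μ ν : Fin d) (x : Site d) {εk εk1 L β₀ : ℝ} (hε : 0 < εk) (hε1 : εk ≤ 1) (hL : 0 < L) (hε' : 0 < εk1)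
    (hflow : εk1 ≤ (1 + β₀) * εk) (hrestr : 2 * (1 + β₀) * L⁻¹ ^ 2 + 4/10 < 1)
    (hdev₀ : ‖plaqF U₀ μ ν x - 1‖ < εk1 * (L⁻¹ * η) ^ 2)
    (hH₁ : ‖H x μ‖ ≤ εk / 10) (hH₂ : ‖H (x + e μ) ν‖ ≤ εk / 10) (hH₃ : ‖H (x + e ν) μ‖ ≤ εk / 10)
    (hH₄ : ‖H x ν‖ ≤ εk / 10) (hDH₁ : ‖covDerivFwd η U₀ μ (fun y => H y ν) x‖ ≤ εk / 10)
    (hDH₂ : ‖covDerivFwd η U₀ ν (fun y => H y μ) x‖ ≤ εk / 10) :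
    ‖plaqF (gaugeAct g (mulCfg (expCfg (iEta η H)) U₀)) μ ν x - 1‖ < εk * η ^ 2 :=
  B14Sect3.ineq38_conclusion _ εk εk1 η L β₀ hε hε1 hη hη1 hL hε' hflow hrestr
    (ineq38_first hη h₀ hH hg μ ν x hdev₀ hH₁ hH₂ hH₃ hH₄ hDH₁ hDH₂)

/-! ## §3 [IV] (1.31): "Estimating ∂U_{j,□} as in (3.8) [III]" -/

/-- **(1.31), FIRST MEMBER** ([IV] p. 184): for `U_{j,□} = (e^{iξℍ}U^{(n)}_k)^{u⁻¹}` ((1.30), `ξ = L^{k−j}η > 0`),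
with *"this function and its covariant derivatives … bounded by … < (β/10)ε_j"* (at the bonds of `∂p` and the two
covariant derivatives at `x`) and the `χ^{(n)}_k`-restriction `|U^{(n)}_k(∂p) − 1| < (1 − β½)ε_jξ²`:
`|U_{j,□}(∂p) − 1| < (1 + (2β/10)ε_jξ)(1 − β½)ε_jξ² + (2β/10)ε_jξ²(1 + (4β/10)ε_j)` = b01's `B15.BasicStep.expr131a β ε_j ξ`
— print's coefficients exactly. [cite: Balaban1989LargeFieldI, (1.31) p.184] -/
theorem ineq131_first {ξ : ℝ} (hξ : 0 < ξ) {U₀ : Site d → Fin d → 𝔸ˣ} (h₀ : ∀ y κ, U₀ y κ ∈ U1 𝔸)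
    {H : Site d → Fin d → 𝔸} (hH : ∀ y κ, IsSelfAdjoint (H y κ)) {g : Site d → 𝔸ˣ} (hg : ∀ y, g y ∈ U1 𝔸)
    (μ ν : Fin d) (x : Site d) {β εj : ℝ} (hdev₀ : ‖plaqF U₀ μ ν x - 1‖ < (1 - β / 2) * εj * ξ ^ 2)
    (hH₁ : ‖H x μ‖ ≤ β / 10 * εj) (hH₂ : ‖H (x + e μ) ν‖ ≤ β / 10 * εj) (hH₃ : ‖H (x + e ν) μ‖ ≤ β / 10 * εj)
    (hH₄ : ‖H x ν‖ ≤ β / 10 * εj) (hDH₁ : ‖covDerivFwd ξ U₀ μ (fun y => H y ν) x‖ ≤ β / 10 * εj)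
    (hDH₂ : ‖covDerivFwd ξ U₀ ν (fun y => H y μ) x‖ ≤ β / 10 * εj) :
    ‖plaqF (gaugeAct g (mulCfg (expCfg (iEta ξ H)) U₀)) μ ν x - 1‖ < B15.BasicStep.expr131a β εj ξ := by
  have h := smallField_transfer hξ h₀ hH hg μ ν x hdev₀ hH₁ hH₂ hH₃ hH₄ hDH₁ hDH₂
  have e1 : (1 + 2 * ξ * (β / 10 * εj)) * ((1 - β / 2) * εj * ξ ^ 2)
        + 2 * ξ ^ 2 * (β / 10 * εj) * (1 + 4 * (β / 10 * εj)) = B15.BasicStep.expr131a β εj ξ := by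
    unfold B15.BasicStep.expr131a
    ring
  linarith [h, e1]

/-- **(1.31), THE WHOLE CHAIN** ([IV] p. 184): `|U_{j,□}(∂p) − 1| < expr131a β ε_j ξ ≤ coeff131 β L·ε_jξ² < ε_jξ²`
(`ξ² = (L^{k−j}η)²`) — the first member from `ineq131_first`, the other two by b01's `B15.BasicStep.expr131a_le`
(with the located smallness `ε_jξ ≤ L⁻²`, `0 ≤ β ≤ 1`, `0 ≤ ε_j ≤ 1`) and `coeff131_lt_one` (`β > 0`, `L ≥ 2`); hence
the (1.3)-function at this plaquette equals `1`. [cite: Balaban1989LargeFieldI, (1.31) p.184] -/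
theorem ineq131_lt {ξ : ℝ} (hξ : 0 < ξ) {U₀ : Site d → Fin d → 𝔸ˣ} (h₀ : ∀ y κ, U₀ y κ ∈ U1 𝔸)
    {H : Site d → Fin d → 𝔸} (hH : ∀ y κ, IsSelfAdjoint (H y κ)) {g : Site d → 𝔸ˣ} (hg : ∀ y, g y ∈ U1 𝔸)
    (μ ν : Fin d) (x : Site d) {β εj L : ℝ} (hβ0 : 0 < β) (hβ1 : β ≤ 1) (hε0 : 0 ≤ εj) (hε1 : εj ≤ 1)
    (hL : 2 ≤ L) (hεξ : εj * ξ ≤ (L ^ 2)⁻¹) (hdev₀ : ‖plaqF U₀ μ ν x - 1‖ < (1 - β / 2) * εj * ξ ^ 2)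
    (hH₁ : ‖H x μ‖ ≤ β / 10 * εj) (hH₂ : ‖H (x + e μ) ν‖ ≤ β / 10 * εj) (hH₃ : ‖H (x + e ν) μ‖ ≤ β / 10 * εj)
    (hH₄ : ‖H x ν‖ ≤ β / 10 * εj) (hDH₁ : ‖covDerivFwd ξ U₀ μ (fun y => H y ν) x‖ ≤ β / 10 * εj)
    (hDH₂ : ‖covDerivFwd ξ U₀ ν (fun y => H y μ) x‖ ≤ β / 10 * εj) :
    ‖plaqF (gaugeAct g (mulCfg (expCfg (iEta ξ H)) U₀)) μ ν x - 1‖ < εj * ξ ^ 2 := by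
  have h1 := ineq131_first hξ h₀ hH hg μ ν x hdev₀ hH₁ hH₂ hH₃ hH₄ hDH₁ hDH₂
  have h2 := B15.BasicStep.expr131a_le hβ0.le hβ1 hε0 hε1 hξ.le hεξ
  have h3 := B15.BasicStep.coeff131_lt_one hβ0 hL
  have hpos : 0 ≤ εj * ξ ^ 2 := by positivity
  have h4 : B15.BasicStep.coeff131 β L * (εj * ξ ^ 2) ≤ 1 * (εj * ξ ^ 2) :=
    mul_le_mul_of_nonneg_right h3.le hpos
  linarith

end Literature.MathematicalPhysics.QuantumFieldTheory.Balaban1983to89.B14Ineq38Proof
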